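import Mathlib
import Literature.RingTheory.MvPowerSeries.FrobeniusPowerBasis
import Summits.ResolutionOfSingularities.ResolutionOfSingularities.Theorems.WeightedInvariantLocalWeightedDropWildMonicShiftOrder

/-!
# `WeightedInvariant.LocalWeightedDrop`, line `hasse-ridge-face-selection`, S3ρ sub-stub S3ρD `stub_wildMonicSurfaceDescent`:
# Perlega Lemma 5.1.1 (2)/(3) and Prop. 5.1.3 — `w`-CLEANNESS MAKES `m = w(J₂)` MAXIMAL under re-centring

Crux item stmt-ResolutionOfSingularities-8899 `LocalWeightedDrop` (route `ResolutionOfSingularities/WeightedInvariant`), engine of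
the door `HypersurfaceCentreConstruction` stmt-ResolutionOfSingularities-19897.  [OURS · L1 W4.3, chain w43, res-L1-w43-stub-7 (second
seat on S3ρ under res-type-083); item (C2) of `L/res-L1-w43-stub-7/S3RHOD-ROADMAP.md`, part B.  MODEL: S. Perlega, thesis Wien 2017 /
arXiv:2011.14443, Ch. 5 §1: Lemma 5.1.1 («(2) if `w(g) > m/c!` then `w(J̃_{-1}) = w(J_{-1})`; (3) if `w(g) < m/c!` … then
`w(J̃_{-1}) = c!·w(g) < w(J_{-1})`»), Lemma 5.1.2 and Prop. 5.1.3 («Let `f ∈ J` be `w`-clean with respect to `J_{-1}`. Then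
`w(J̃_{-1}) ≤ w(J_{-1})`»).  Nothing here is a statement of H. Hironaka's manuscript [claim: Hironaka2017, status: under-review];
OUR objects: the tuple `A` (a position, `f_d = 1`), `WildMonic.shift d A g` (res-type-083), `WildMonic.wMin/slotWOrd/IsWClean`
(`…WildMonicWClean`), with `G := d!·ord_w(g)` playing `c!·w(g)` and `m := wMin w A` playing `w(J_{-1})`.]

* `min_le_slotWOrd_shift` — every scaled slot order of the re-centred tuple is `≥ min(m, G)`;
* `wMin_shift_eq_of_lt` — LEMMA 5.1.1 (2): `m < G ⇒ m(shift d A g) = m`;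
* `wMin_shift_eq_of_gt` — LEMMA 5.1.1 (3): `G < m ⇒ m(shift d A g) = G` (`d ≥ 1`);
* `wMin_shift_le_of_isWClean` — PROP. 5.1.3: if the position is `w`-CLEAN then `m(shift d A g) ≤ m` for EVERY `g` — cleanness makes
  the weighted order of the coefficient ideal maximal over all hypersurfaces `V(y + g)`; the three cleanness cases are Perlega's
  Lemma 5.1.2 (i)/(ii)/(iii): a maximal attaining slot in `(d−q, d)` keeps its order (`C(d,i) = 0` there); else the slot `d−q` receives
  `C(d,q)·g^q` of scaled order exactly `m` (`C(d,q) ≠ 0`); else the `w`-initial part of `A_{d−q}`, having an exponent outside `qℕ²`,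
  cannot be cancelled by the `q`-th power `C(d,q) g^q` (res-type-0xx's `Literature.RingTheory.MvPowerSeries.isSupportedOnMultiples_pow`).
-/

set_option linter.dupNamespace false -- mandated namespace of this single-conjunct summit

namespace Summit.ResolutionOfSingularities.ResolutionOfSingularities.Theorems

namespace WildMonic

open MvPowerSeries

variable {k : Type} [Field k] (w : Fin 2 → ℕ) {d : ℕ} (A : Fin d → MvPowerSeries (Fin 2) k) (g : MvPowerSeries (Fin 2) k)

/-! ## Shared bounds -/

/-- Every scaled slot order of the re-centred tuple is `≥ min(m, G)`. -/
theorem min_le_slotWOrd_shift (i : Fin d) :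
    min (wMin w A) ((d.factorial : ℕ∞) * g.weightedOrder w) ≤ slotWOrd w (shift d A g) i := by
  unfold slotWOrd
  rw [shift_eq]
  have hc : (slotWeight d i : ℕ∞) ≠ 0 := by exact_mod_cast (slotWeight_pos i).ne'
  exact le_mul_weightedOrder_add w (le_trans (min_le_right _ _) (le_slotWeight_mul_weightedOrder_top w g i))
    (le_mul_weightedOrder_finset_sum w _ _ hc fun j _ => min_le_slotWeight_mul_weightedOrder_term w A g i j)

/-- `m` is attained by a slot (when `d ≥ 1`). -/
theorem exists_slotWOrd_eq_wMin (hd : 0 < d) : ∃ i : Fin d, slotWOrd w A i = wMin w A := by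
  haveI : Nonempty (Fin d) := ⟨⟨0, hd⟩⟩
  exact ciInf_mem (fun j : Fin d => slotWOrd w A j)

/-- The diagonal term of `shift_eq` is the slot itself: `C(i,i) A_i g^0 = A_i`. -/
theorem shift_term_self (i : Fin d) :
    (((i : ℕ).choose i : ℕ) : MvPowerSeries (Fin 2) k) * A i * g ^ ((i : ℕ) - i) = A i := by
  rw [Nat.choose_self, Nat.cast_one, one_mul, Nat.sub_self, pow_zero, mul_one]

/-- The terms BELOW the diagonal vanish: `C(j,i) = 0` for `j < i`. -/
theorem shift_term_of_lt {i j : Fin d} (hji : (j : ℕ) < i) :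
    (((j : ℕ).choose i : ℕ) : MvPowerSeries (Fin 2) k) * A j * g ^ ((j : ℕ) - i) = 0 := by
  rw [Nat.choose_eq_zero_of_lt hji, Nat.cast_zero, zero_mul, zero_mul]

/-- Cancelling the slot weight in a strict inequality. -/
theorem lt_of_slotWeight_mul_lt (i : Fin d) {x y : ℕ∞} (h : (slotWeight d i : ℕ∞) * x < (slotWeight d i : ℕ∞) * y) : x < y :=
  lt_of_mul_lt_mul_left h bot_le

/-- `n · m ≠ ⊤` for `m` finite. -/
theorem natCast_mul_ne_top (n : ℕ) {m : ℕ∞} (hm : m ≠ ⊤) : (n : ℕ∞) * m ≠ ⊤ := WithTop.mul_ne_top (ENat.coe_ne_top n) hm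

/-- Strict monotonicity of `n · _` on `ℕ∞` for `n ≠ 0`. -/
theorem natCast_mul_lt_natCast_mul {n : ℕ} (hn : n ≠ 0) {x y : ℕ∞} (h : x < y) : (n : ℕ∞) * x < (n : ℕ∞) * y :=
  ENat.mul_right_strictMono (by exact_mod_cast hn) (ENat.coe_ne_top n) h

/-- A slot with finite scaled order has a finite weighted order. -/
theorem weightedOrder_ne_top_of_slotWOrd_ne_top {i : Fin d} (h : slotWOrd w A i ≠ ⊤) : (A i).weightedOrder w ≠ ⊤ := by
  intro ht
  apply h
  unfold slotWOrd
  rw [ht, ENat.mul_top (by exact_mod_cast (slotWeight_pos i).ne')]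

/-- A STRICT lower bound for a term ABOVE the diagonal: if `m ≤ s_j`, `m ≤ G`, one of them strictly and `m` finite, then
`m < N_i · ord_w(C(j,i) A_j g^{j−i})` (`i < j`). -/
theorem slotWeight_mul_lt_term {i j : Fin d} (hij : (i : ℕ) < j) {m : ℕ∞} (hm : m ≠ ⊤)
    (hsj : m ≤ slotWOrd w A j) (hG : m ≤ (d.factorial : ℕ∞) * g.weightedOrder w)
    (hstrict : m < slotWOrd w A j ∨ m < (d.factorial : ℕ∞) * g.weightedOrder w) :
    m < (slotWeight d i : ℕ∞) * ((((j : ℕ).choose i : ℕ) : MvPowerSeries (Fin 2) k) * A j * g ^ ((j : ℕ) - i)).weightedOrder w := by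
  refine lt_of_sub_mul_lt i ?_
  have hdj : (d - (j : ℕ) : ℕ) ≠ 0 := by have := j.2; omega
  have hji : ((j : ℕ) - i : ℕ) ≠ 0 := by omega
  have hdi : ((d - (i : ℕ) : ℕ) : ℕ∞) = ((d - (j : ℕ) : ℕ) : ℕ∞) + (((j : ℕ) - i : ℕ) : ℕ∞) := by
    rw [← Nat.cast_add]; congr 1; have := j.2; omega
  have hkey : ((d - (j : ℕ) : ℕ) : ℕ∞) * m + (((j : ℕ) - i : ℕ) : ℕ∞) * m <
      ((d - (j : ℕ) : ℕ) : ℕ∞) * slotWOrd w A j + (((j : ℕ) - i : ℕ) : ℕ∞) * ((d.factorial : ℕ∞) * g.weightedOrder w) := by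
    rcases hstrict with h | h
    · calc ((d - (j : ℕ) : ℕ) : ℕ∞) * m + (((j : ℕ) - i : ℕ) : ℕ∞) * m
          < ((d - (j : ℕ) : ℕ) : ℕ∞) * slotWOrd w A j + (((j : ℕ) - i : ℕ) : ℕ∞) * m :=
            (ENat.add_lt_add_iff_right (natCast_mul_ne_top _ hm)).mpr (natCast_mul_lt_natCast_mul hdj h)
        _ ≤ _ := by gcongr
    · calc ((d - (j : ℕ) : ℕ) : ℕ∞) * m + (((j : ℕ) - i : ℕ) : ℕ∞) * m
          < ((d - (j : ℕ) : ℕ) : ℕ∞) * m + (((j : ℕ) - i : ℕ) : ℕ∞) * ((d.factorial : ℕ∞) * g.weightedOrder w) :=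
            (ENat.add_lt_add_iff_left (natCast_mul_ne_top _ hm)).mpr (natCast_mul_lt_natCast_mul hji h)
        _ ≤ _ := by gcongr
  have hmono : (A j * g ^ ((j : ℕ) - i)).weightedOrder w ≤
      ((((j : ℕ).choose i : ℕ) : MvPowerSeries (Fin 2) k) * A j * g ^ ((j : ℕ) - i)).weightedOrder w := by
    rw [mul_assoc]; exact weightedOrder_le_natCast_mul w _ _
  calc ((d - (i : ℕ) : ℕ) : ℕ∞) * m
      = ((d - (j : ℕ) : ℕ) : ℕ∞) * m + (((j : ℕ) - i : ℕ) : ℕ∞) * m := by rw [hdi, add_mul]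
    _ < ((d - (j : ℕ) : ℕ) : ℕ∞) * slotWOrd w A j + (((j : ℕ) - i : ℕ) : ℕ∞) * ((d.factorial : ℕ∞) * g.weightedOrder w) := hkey
    _ = ((d - (i : ℕ) : ℕ) : ℕ∞) * ((slotWeight d i : ℕ∞) * (A j * g ^ ((j : ℕ) - i)).weightedOrder w) :=
        (slot_term_identity w A g i j).symm
    _ ≤ _ := by gcongr

/-! ## Lemma 5.1.1 (2): `G > m` -/

/-- If `m` is finite then `d ≥ 1`. -/
theorem pos_of_wMin_ne_top (hm : wMin w A ≠ ⊤) : 0 < d := by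
  rcases Nat.eq_zero_or_pos d with h0 | h0
  · exfalso; apply hm; subst h0; unfold wMin; exact iInf_of_empty _
  · exact h0

/-- THE KEPT SLOT: if slot `i` attains `m < ⊤`, every LATER slot `j > i` has `s_j > m` OR `G > m` (with `s_j, G ≥ m`), and the top
coefficient `C(d,i)·g^{d−i}` has scaled order `> m`, then the slot `i` of the re-centred tuple still has scaled order `m`. -/
theorem slotWOrd_shift_eq_of_kept (i : Fin d) (hi : slotWOrd w A i = wMin w A) (hm : wMin w A ≠ ⊤)
    (hG : wMin w A ≤ (d.factorial : ℕ∞) * g.weightedOrder w)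
    (hlater : ∀ j : Fin d, (i : ℕ) < j → wMin w A < slotWOrd w A j ∨ wMin w A < (d.factorial : ℕ∞) * g.weightedOrder w)
    (htop : wMin w A < (slotWeight d i : ℕ∞) * (((d.choose i : ℕ) : MvPowerSeries (Fin 2) k) * g ^ (d - (i : ℕ))).weightedOrder w) :
    slotWOrd w (shift d A g) i = wMin w A := by
  have hAi : (A i).weightedOrder w ≠ ⊤ := weightedOrder_ne_top_of_slotWOrd_ne_top w A (by rw [hi]; exact hm)
  have hNi : (slotWeight d i : ℕ∞) ≠ 0 := by exact_mod_cast (slotWeight_pos i).ne'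
  -- the sum of the lower terms has the order of `A_i`
  have hsum : (∑ j : Fin d, (((j : ℕ).choose i : ℕ) : MvPowerSeries (Fin 2) k) * A j * g ^ ((j : ℕ) - i)).weightedOrder w =
      (A i).weightedOrder w := by
    rw [weightedOrder_finset_sum_eq_of_lt w Finset.univ _ (Finset.mem_univ i), shift_term_self]
    intro j _ hji
    rw [shift_term_self]
    rcases lt_or_gt_of_ne (Fin.val_injective.ne hji) with hlt | hgt
    · rw [shift_term_of_lt A g hlt, weightedOrder_zero]; exact lt_top_iff_ne_top.mpr hAi
    · refine lt_of_slotWeight_mul_lt i ?_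
      calc (slotWeight d i : ℕ∞) * (A i).weightedOrder w = wMin w A := hi
        _ < _ := slotWeight_mul_lt_term w A g hgt hm (wMin_le_slotWOrd w A j) hG (hlater j hgt)
  have hlt : (∑ j : Fin d, (((j : ℕ).choose i : ℕ) : MvPowerSeries (Fin 2) k) * A j * g ^ ((j : ℕ) - i)).weightedOrder w <
      (((d.choose i : ℕ) : MvPowerSeries (Fin 2) k) * g ^ (d - (i : ℕ))).weightedOrder w := by
    rw [hsum]
    refine lt_of_slotWeight_mul_lt i ?_
    calc (slotWeight d i : ℕ∞) * (A i).weightedOrder w = wMin w A := hi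
      _ < _ := htop
  unfold slotWOrd at hi ⊢
  rw [shift_eq, weightedOrder_add_of_weightedOrder_ne w hlt.ne', min_eq_right hlt.le, hsum, hi]

/-- PERLEGA LEMMA 5.1.1 (2): if `G = d!·ord_w(g) > m` then `m(shift d A g) = m` — every attaining slot is kept. -/
theorem wMin_shift_eq_of_lt (hG : wMin w A < (d.factorial : ℕ∞) * g.weightedOrder w) : wMin w (shift d A g) = wMin w A := by
  have hm : wMin w A ≠ ⊤ := ne_top_of_lt hG
  obtain ⟨i, hi⟩ := exists_slotWOrd_eq_wMin w A (pos_of_wMin_ne_top w A hm)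
  refine le_antisymm (le_trans (wMin_le_slotWOrd w (shift d A g) i) (le_of_eq ?_)) (wMin_le_wMin_shift w A g hG.le)
  refine slotWOrd_shift_eq_of_kept w A g i hi hm hG.le (fun j _ => Or.inr hG) ?_
  exact lt_of_lt_of_le hG (le_slotWeight_mul_weightedOrder_top w g i)

/-! ## Lemma 5.1.1 (3): `G < m` -/

/-- PERLEGA LEMMA 5.1.1 (3): if `G = d!·ord_w(g) < m` then `m(shift d A g) = G` — the slot `0` becomes `g^d + (higher)`. -/
theorem wMin_shift_eq_of_gt (hd : 0 < d) (hG : (d.factorial : ℕ∞) * g.weightedOrder w < wMin w A) :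
    wMin w (shift d A g) = (d.factorial : ℕ∞) * g.weightedOrder w := by
  set G := (d.factorial : ℕ∞) * g.weightedOrder w with hGdef
  have hGfin : G ≠ ⊤ := ne_top_of_lt hG
  have hgfin : g.weightedOrder w ≠ ⊤ := fun h => hGfin (by rw [hGdef, h, ENat.mul_top (by exact_mod_cast (Nat.factorial_pos d).ne')])
  apply le_antisymm
  · -- slot `0`
    set i₀ : Fin d := ⟨0, hd⟩
    refine le_trans (wMin_le_slotWOrd w (shift d A g) i₀) (le_of_eq ?_)
    have hN0 : (slotWeight d i₀ : ℕ∞) ≠ 0 := by exact_mod_cast (slotWeight_pos i₀).ne'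
    -- the top term has scaled order exactly `G`
    have htop : (slotWeight d i₀ : ℕ∞) * (((d.choose i₀ : ℕ) : MvPowerSeries (Fin 2) k) * g ^ (d - (i₀ : ℕ))).weightedOrder w = G := by
      rw [show ((i₀ : ℕ)) = 0 from rfl, Nat.choose_zero_right, Nat.cast_one, one_mul, Nat.sub_zero, weightedOrder_pow_eq,
        ← mul_assoc, ← Nat.cast_mul]
      unfold slotWeight
      rw [Nat.sub_zero, Nat.div_mul_cancel (Nat.dvd_factorial hd le_rfl)]
    -- every lower term is strictly above `G`
    have hterms : ∀ j : Fin d, G < (slotWeight d i₀ : ℕ∞) *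
        ((((j : ℕ).choose i₀ : ℕ) : MvPowerSeries (Fin 2) k) * A j * g ^ ((j : ℕ) - i₀)).weightedOrder w := by
      intro j
      refine lt_of_sub_mul_lt i₀ ?_
      have hdj : (d - (j : ℕ) : ℕ) ≠ 0 := by have := j.2; omega
      have hdi : ((d - (i₀ : ℕ) : ℕ) : ℕ∞) = ((d - (j : ℕ) : ℕ) : ℕ∞) + (((j : ℕ) - i₀ : ℕ) : ℕ∞) := by
        rw [← Nat.cast_add]; congr 1; have := j.2; simp only [show ((i₀ : ℕ)) = 0 from rfl]; omega
      have hmono : (A j * g ^ ((j : ℕ) - i₀)).weightedOrder w ≤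
          ((((j : ℕ).choose i₀ : ℕ) : MvPowerSeries (Fin 2) k) * A j * g ^ ((j : ℕ) - i₀)).weightedOrder w := by
        rw [mul_assoc]; exact weightedOrder_le_natCast_mul w _ _
      calc ((d - (i₀ : ℕ) : ℕ) : ℕ∞) * G
          = ((d - (j : ℕ) : ℕ) : ℕ∞) * G + (((j : ℕ) - i₀ : ℕ) : ℕ∞) * G := by rw [hdi, add_mul]
        _ < ((d - (j : ℕ) : ℕ) : ℕ∞) * slotWOrd w A j + (((j : ℕ) - i₀ : ℕ) : ℕ∞) * G :=
            (ENat.add_lt_add_iff_right (natCast_mul_ne_top _ hGfin)).mpr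
              (natCast_mul_lt_natCast_mul hdj (lt_of_lt_of_le hG (wMin_le_slotWOrd w A j)))
        _ = ((d - (i₀ : ℕ) : ℕ) : ℕ∞) * ((slotWeight d i₀ : ℕ∞) * (A j * g ^ ((j : ℕ) - i₀)).weightedOrder w) :=
            (slot_term_identity w A g i₀ j).symm
        _ ≤ _ := by gcongr
    have hsumgt : G < (slotWeight d i₀ : ℕ∞) *
        (∑ j : Fin d, (((j : ℕ).choose i₀ : ℕ) : MvPowerSeries (Fin 2) k) * A j * g ^ ((j : ℕ) - i₀)).weightedOrder w := by
      -- the sum is at least the least term, which is `> G`; use the finite minimum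
      obtain ⟨n, hn⟩ := ENat.ne_top_iff_exists.mp hGfin
      have h1 : G + 1 ≤ (slotWeight d i₀ : ℕ∞) *
          (∑ j : Fin d, (((j : ℕ).choose i₀ : ℕ) : MvPowerSeries (Fin 2) k) * A j * g ^ ((j : ℕ) - i₀)).weightedOrder w :=
        le_mul_weightedOrder_finset_sum w _ _ hN0 fun j _ => Order.add_one_le_of_lt (hterms j)
      refine lt_of_lt_of_le ?_ h1
      rw [← hn, ← ENat.coe_one, ← ENat.coe_add, ENat.coe_lt_coe]; omega
    unfold slotWOrd
    rw [shift_eq]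
    have hne : (((d.choose i₀ : ℕ) : MvPowerSeries (Fin 2) k) * g ^ (d - (i₀ : ℕ))).weightedOrder w ≠
        (∑ j : Fin d, (((j : ℕ).choose i₀ : ℕ) : MvPowerSeries (Fin 2) k) * A j * g ^ ((j : ℕ) - i₀)).weightedOrder w := by
      intro h
      rw [← htop, h] at hsumgt
      exact lt_irrefl _ hsumgt
    have hle : (((d.choose i₀ : ℕ) : MvPowerSeries (Fin 2) k) * g ^ (d - (i₀ : ℕ))).weightedOrder w ≤
        (∑ j : Fin d, (((j : ℕ).choose i₀ : ℕ) : MvPowerSeries (Fin 2) k) * A j * g ^ ((j : ℕ) - i₀)).weightedOrder w := by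
      refine le_of_lt (lt_of_slotWeight_mul_lt i₀ ?_)
      rw [htop]; exact hsumgt
    rw [weightedOrder_add_of_weightedOrder_ne w hne, min_eq_left hle, htop]
  · exact le_iInf fun i => le_trans (le_of_eq (min_eq_right hG.le).symm) (min_le_slotWOrd_shift w A g i)

/-! ## Prop. 5.1.3: cleanness makes `m` maximal -/

section Clean

variable (p : ℕ) [Fact p.Prime] [CharP k p]

/-- The top coefficient VANISHES on the slots `d − q < i < d` (Lemma (c−q)). -/
theorem shift_top_eq_zero_of_gt {i : Fin d} (hi : d - qOf p d < (i : ℕ)) :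
    ((d.choose i : ℕ) : MvPowerSeries (Fin 2) k) * g ^ (d - (i : ℕ)) = 0 := by
  rw [← map_natCast (C : k →+* MvPowerSeries (Fin 2) k), natCast_choose_eq_zero_of_gt (k := k) p hi i.2, map_zero, zero_mul]

/-- The top coefficient of the slot `d − q` has scaled order EXACTLY `G` (`C(d,q) ≠ 0`). -/
theorem slotWeight_mul_weightedOrder_top_eq {i : Fin d} (hi : (i : ℕ) = d - qOf p d) :
    (slotWeight d i : ℕ∞) * (((d.choose i : ℕ) : MvPowerSeries (Fin 2) k) * g ^ (d - (i : ℕ))).weightedOrder w =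
      (d.factorial : ℕ∞) * g.weightedOrder w := by
  have hd : 0 < d := Fin.pos i
  have hq : qOf p d ≤ d := Nat.le_of_dvd hd (qOf_dvd p d)
  have hdi : d - (i : ℕ) = qOf p d := by omega
  have hne : ((d.choose i : ℕ) : k) ≠ 0 := by
    rw [← Nat.choose_symm i.2.le, hdi]; exact natCast_choose_qOf_ne_zero (k := k) p hd
  rw [← map_natCast (C : k →+* MvPowerSeries (Fin 2) k), weightedOrder_C_mul_of_ne_zero w hne, weightedOrder_pow_eq, ← mul_assoc,
    ← Nat.cast_mul, mul_comm (slotWeight d i) (d - (i : ℕ)), sub_mul_slotWeight]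

/-- A `q`-th power (`q = p^ℓ`) has no coefficient off the lattice `qℕ²`. -/
theorem coeff_pow_qOf_eq_zero (g : MvPowerSeries (Fin 2) k) {e : Fin 2 →₀ ℕ} (he : ¬ (qOf p d ∣ e 0 ∧ qOf p d ∣ e 1)) :
    coeff e (g ^ qOf p d) = 0 := by
  haveI : ExpChar k p := ExpChar.prime (Fact.out : p.Prime)
  have h := Literature.RingTheory.MvPowerSeries.isSupportedOnMultiples_pow p g (d.factorization p)
  refine h e ?_
  by_contra hall
  push Not at hall
  exact he ⟨hall 0, hall 1⟩

/-- A scaled STRICT lower bound passes to a finite sum (for a finite bound). -/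
theorem lt_mul_weightedOrder_finset_sum {ι : Type*} (s : Finset ι) (f : ι → MvPowerSeries (Fin 2) k) {c n : ℕ∞} (hc : c ≠ 0)
    (hn : n ≠ ⊤) (h : ∀ i ∈ s, n < c * (f i).weightedOrder w) : n < c * (∑ i ∈ s, f i).weightedOrder w := by
  obtain ⟨n₀, hn₀⟩ := ENat.ne_top_iff_exists.mp hn
  have h1 : n + 1 ≤ c * (∑ i ∈ s, f i).weightedOrder w :=
    le_mul_weightedOrder_finset_sum w _ _ hc fun j hj => Order.add_one_le_of_lt (h j hj)
  refine lt_of_lt_of_le ?_ h1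
  rw [← hn₀, ← ENat.coe_one, ← ENat.coe_add, ENat.coe_lt_coe]; omega

/-- THE SLOT `d − q` WHEN IT DOES NOT ATTAIN: if `G = m < s_{d−q}` and no slot above `d − q` attains `m`, then after re-centring the
slot `d − q` has scaled order exactly `m` (it receives `C(d,q)·g^q`; Perlega Lemma 5.1.2 (ii)). -/
theorem slotWOrd_shift_eq_of_top {i : Fin d} (hi : (i : ℕ) = d - qOf p d) (hm : wMin w A ≠ ⊤)
    (heq : wMin w A = (d.factorial : ℕ∞) * g.weightedOrder w) (hsi : wMin w A < slotWOrd w A i)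
    (hlater : ∀ j : Fin d, d - qOf p d < (j : ℕ) → wMin w A < slotWOrd w A j) :
    slotWOrd w (shift d A g) i = wMin w A := by
  have hNi : (slotWeight d i : ℕ∞) ≠ 0 := by exact_mod_cast (slotWeight_pos i).ne'
  have htop : (slotWeight d i : ℕ∞) * (((d.choose i : ℕ) : MvPowerSeries (Fin 2) k) * g ^ (d - (i : ℕ))).weightedOrder w =
      wMin w A := by rw [slotWeight_mul_weightedOrder_top_eq w g p hi, ← heq]
  have hsum : wMin w A < (slotWeight d i : ℕ∞) *
      (∑ j : Fin d, (((j : ℕ).choose i : ℕ) : MvPowerSeries (Fin 2) k) * A j * g ^ ((j : ℕ) - i)).weightedOrder w := by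
    refine lt_mul_weightedOrder_finset_sum w _ _ hNi hm fun j _ => ?_
    rcases Nat.lt_trichotomy (j : ℕ) i with hlt | hji | hgt
    · rw [shift_term_of_lt A g hlt, weightedOrder_zero, ENat.mul_top hNi]; exact lt_top_iff_ne_top.mpr hm
    · rw [Fin.ext hji, shift_term_self]; exact hsi
    · exact slotWeight_mul_lt_term w A g hgt hm (wMin_le_slotWOrd w A j) heq.le (Or.inl (hlater j (by omega)))
  have hlt : (((d.choose i : ℕ) : MvPowerSeries (Fin 2) k) * g ^ (d - (i : ℕ))).weightedOrder w <
      (∑ j : Fin d, (((j : ℕ).choose i : ℕ) : MvPowerSeries (Fin 2) k) * A j * g ^ ((j : ℕ) - i)).weightedOrder w := by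
    refine lt_of_slotWeight_mul_lt i ?_
    rw [htop]; exact hsum
  unfold slotWOrd
  rw [shift_eq, weightedOrder_add_of_weightedOrder_ne w hlt.ne, min_eq_left hlt.le]
  exact htop

/-- THE SLOT `d − q` WHEN IT ATTAINS AND ITS INITIAL PART IS NOT A `q`-TH POWER: if `G = m = s_{d−q}`, no slot above `d − q` attains
`m`, and the `w`-initial part of `A_{d−q}` has an exponent `e ∉ qℕ²`, then after re-centring the slot `d − q` still has scaled order `m`
(the coefficient at `e` survives; Perlega Lemma 5.1.2 (iii) + property `(3)_w`). -/
theorem slotWOrd_shift_eq_of_initSupp {i : Fin d} (hi : (i : ℕ) = d - qOf p d) (hm : wMin w A ≠ ⊤)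
    (heq : wMin w A = (d.factorial : ℕ∞) * g.weightedOrder w) (hsi : slotWOrd w A i = wMin w A)
    (hlater : ∀ j : Fin d, d - qOf p d < (j : ℕ) → wMin w A < slotWOrd w A j)
    {e : Fin 2 →₀ ℕ} (he : e ∈ initSupp w (A i)) (hndvd : ¬ (qOf p d ∣ e 0 ∧ qOf p d ∣ e 1)) :
    slotWOrd w (shift d A g) i = wMin w A := by
  have hd : 0 < d := Fin.pos i
  have hq : qOf p d ≤ d := Nat.le_of_dvd hd (qOf_dvd p d)
  have hdi : d - (i : ℕ) = qOf p d := by omega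
  have hNi : (slotWeight d i : ℕ∞) ≠ 0 := by exact_mod_cast (slotWeight_pos i).ne'
  obtain ⟨hecoeff, hewt⟩ := he
  -- the coefficient at `e` of the re-centred slot is that of `A_i`
  have hcoeff : coeff e (shift d A g i) = coeff e (A i) := by
    rw [shift_eq, map_add, map_sum, Finset.sum_eq_single i]
    · rw [shift_term_self, hdi, ← map_natCast (C : k →+* MvPowerSeries (Fin 2) k), coeff_C_mul, coeff_pow_qOf_eq_zero p g hndvd,
        mul_zero, zero_add]
    · intro j _ hji
      rcases lt_or_gt_of_ne (Fin.val_injective.ne hji) with hlt | hgt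
      · rw [shift_term_of_lt A g hlt, map_zero]
      · apply coeff_eq_zero_of_lt_weightedOrder w
        rw [hewt]
        refine lt_of_slotWeight_mul_lt i ?_
        calc (slotWeight d i : ℕ∞) * (A i).weightedOrder w = wMin w A := hsi
          _ < _ := slotWeight_mul_lt_term w A g hgt hm (wMin_le_slotWOrd w A j) heq.le (Or.inl (hlater j (by omega)))
    · intro h; exact absurd (Finset.mem_univ i) h
  apply le_antisymm
  · unfold slotWOrd at hsi ⊢
    calc (slotWeight d i : ℕ∞) * (shift d A g i).weightedOrder w ≤ (slotWeight d i : ℕ∞) * (Finsupp.weight w e : ℕ) := by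
          gcongr
          exact weightedOrder_le w (by rw [hcoeff]; exact hecoeff)
      _ = wMin w A := by rw [hewt, hsi]
  · exact le_trans (le_of_eq (min_eq_left heq.le).symm) (min_le_slotWOrd_shift w A g i)

/-- PERLEGA PROP. 5.1.3 (cleanness = maximality): if the position `A` is `w`-CLEAN then for EVERY re-centring `g` the scaled weighted
order of the coefficient ideal does not go up: `m(shift d A g) ≤ m(A)`. -/
theorem wMin_shift_le_of_isWClean (hclean : IsWClean p w A) (hm : wMin w A ≠ ⊤) : wMin w (shift d A g) ≤ wMin w A := by
  have hd : 0 < d := pos_of_wMin_ne_top w A hm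
  rcases lt_trichotomy (wMin w A) ((d.factorial : ℕ∞) * g.weightedOrder w) with hlt | heq | hgt
  · exact (wMin_shift_eq_of_lt w A g hlt).le
  swap
  · rw [wMin_shift_eq_of_gt w A g hd hgt]; exact hgt.le
  -- the case `G = m`: exhibit a slot of the re-centred tuple with scaled order `m`
  classical
  by_cases h1 : ∃ i : Fin d, d - qOf p d < (i : ℕ) ∧ slotWOrd w A i = wMin w A
  · -- (1)_w: the LAST attaining slot above `d − q` is kept
    let T : Finset (Fin d) := Finset.univ.filter fun i => d - qOf p d < (i : ℕ) ∧ slotWOrd w A i = wMin w A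
    obtain ⟨i₁, hi₁, hs₁⟩ := h1
    have hT : T.Nonempty := ⟨i₁, Finset.mem_filter.mpr ⟨Finset.mem_univ _, hi₁, hs₁⟩⟩
    obtain ⟨-, hiT1, hiT2⟩ := Finset.mem_filter.mp (Finset.max'_mem T hT)
    refine le_trans (wMin_le_slotWOrd w (shift d A g) (T.max' hT)) (le_of_eq ?_)
    refine slotWOrd_shift_eq_of_kept w A g _ hiT2 hm heq.le (fun j hj => Or.inl ?_) ?_
    · refine lt_of_le_of_ne (wMin_le_slotWOrd w A j) fun hsj => ?_
      have hjT : j ∈ T := Finset.mem_filter.mpr ⟨Finset.mem_univ _, by omega, hsj.symm⟩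
      exact absurd (Finset.le_max' T j hjT) (not_le.mpr (Fin.lt_def.mpr hj))
    · rw [shift_top_eq_zero_of_gt g p hiT1, weightedOrder_zero, ENat.mul_top (by exact_mod_cast (slotWeight_pos _).ne')]
      exact lt_top_iff_ne_top.mpr hm
  · have hlater : ∀ j : Fin d, d - qOf p d < (j : ℕ) → wMin w A < slotWOrd w A j := fun j hj =>
      lt_of_le_of_ne (wMin_le_slotWOrd w A j) fun hsj => h1 ⟨j, hj, hsj.symm⟩
    set i : Fin d := ⟨d - qOf p d, by have := qOf_pos p d; omega⟩ with hidef
    have hi : (i : ℕ) = d - qOf p d := rfl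
    refine le_trans (wMin_le_slotWOrd w (shift d A g) i) (le_of_eq ?_)
    by_cases h2 : wMin w A < slotWOrd w A i
    · -- (2)_w
      exact slotWOrd_shift_eq_of_top w A g p hi hm heq h2 hlater
    · -- (3)_w
      have hsi : slotWOrd w A i = wMin w A := le_antisymm (not_lt.mp h2) (wMin_le_slotWOrd w A i)
      rcases hclean with h1' | h2' | ⟨i', e, hi', he, hndvd⟩
      · exact absurd h1' h1
      · exact absurd (h2' i hi) h2
      · have hii' : i' = i := Fin.ext (by rw [hi', hi])
        subst hii'
        exact slotWOrd_shift_eq_of_initSupp w A g p hi hm heq hsi hlater he hndvd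

end Clean

end WildMonic

end Summit.ResolutionOfSingularities.ResolutionOfSingularities.Theorems
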